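import Mathlib.MeasureTheory.Integral.Prod
import Mathlib.MeasureTheory.Integral.ExpDecay
import Mathlib.Analysis.SpecialFunctions.Trigonometric.DerivHyp
import Literature.Analysis.SpecialFunctions.ArcsinePoissonIntegral
import Literature.Analysis.SpecialFunctions.TanhPartialFractions
import Literature.Analysis.FunctionSpaces.BesselJPoissonIntegral
import Literature.Analysis.FunctionSpaces.BesselJProofs
import HarnessLib

/-!
# The Fermi-weighted Bessel integral `∫₀^∞ cos(sω) J₀(ω) dω/(1 + e^{aω})`: Lieb–Wu's representation and bound

For `a > 0` and `|s| < 1` let `I(a, s) = ∫₀^∞ cos(sω) J₀(ω)/(1 + e^{aω}) dω` (`fermiCosJ0 a s`).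
Lieb–Wu's momentum density of the half-filled Hubbard chain is `ρ₀(k) = 1/(2π) + (cos k/π) I(U/2, sin k)`
(Physica A 321 (2003) 1, §6), and their Lemma 5 (`0 < ρ₀ < 1/(2π)` for `cos k < 0`,
`1/(2π) < ρ₀ < 1/π` for `cos k > 0`) is equivalent to

  `0 < I(a, s)` and `2 I(a, s) < 1/√(1 - s²)`   (`fermiCosJ0_pos`, `two_mul_fermiCosJ0_lt`).

Lieb–Wu prove it by expanding the Fermi factor, `I = Σ_{n ≥ 1} (-1)^{n+1} P(na, s)` with
`P(c, s) = ∫₀^∞ e^{-cω} cos(sω) J₀(ω) dω = Re[(c - is)² + 1]^{-1/2}` (Gradshteyn–Ryzhik 6.611(1)), and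
evaluating the conditionally convergent alternating sum by a contour integral around the branch
cuts, which yields the manifestly positive formula (rhoeye):
`ρ₀(k) = (1/2π)[1 + sgn cos k] - (cos k/(2πU)) [I₋(k) + I₊(k)]`,
`I_±(k) = ∫₀^∞ dx / sinh((2π/U)(cosh x ± sin k))`. This file proves the same representation by
real-variable means:

1. `integral_exp_neg_mul_cos_mul_besselJ_eq_integral_cauchyMixKernel`: Poisson's integral `J₀(ω) = π⁻¹ ∫₀^π cos(ω cos θ) dθ`,
   Fubini and `∫₀^∞ e^{-cω} cos(bω) dω = c/(c² + b²)` give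
   `P(c, s) = π⁻¹ ∫₀^π c dθ/(c² + (s - cos θ)²) = π⁻¹ ∫_ℝ m(c, s, t) dt`, a POSITIVE MIXTURE of
   Cauchy profiles in `c` (`Literature.Analysis.SpecialFunctions.ArcsinePoissonIntegral`); hence
   `P(·, s)` is positive and strictly decreasing.
2. `tendsto_sum_laplaceCosJ0`: `Σ_{n<N} (-1)ⁿ P((n+1)a, s) → I(a, s)` (dominated convergence, the
   partial sums of `Σ (-1)ⁿ e^{-(n+1)aω}` being bounded by `2e^{-aω}`); pairing consecutive terms,
   `I = Σ_m [P((2m+1)a) - P((2m+2)a)]`, a series of nonnegative terms (`hasSum_laplaceCosJ0_pair`),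
   so `I > 0`.
3. `hasSum_cauchy_alternating`: for each profile,
   `Σ_m [β/(β² + ((2m+1)a)²) - β/(β² + ((2m+2)a)²)] = 1/(2β) - (π/(2a))/sinh(πβ/a)`, the
   Mittag-Leffler expansion `1/sinh x - 1/x = Σ_{n ≥ 1} (-1)ⁿ 2x/(x² + n²π²)` (from those of
   `coth x` and `coth(x/2)`, `Literature.Analysis.SpecialFunctions.hasSum_coth_sub_inv`).
4. `pi_mul_fermiCosJ0_eq`: summing under the `t`-integral (monotone convergence),
   `π I(a, s) = π/(2√(1 - s²)) - ∫_ℝ R(t) dt`,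
   `R(t) = (π/(4ab)) [1/sinh(π(b - s)/a) + 1/sinh(π(b + s)/a)] > 0`, `b = √(1 + t²)` — with
   `b = cosh x` this is exactly Lieb–Wu's `I₋ + I₊`. Hence `2I < 1/√(1 - s²)`.

## References

* E. H. Lieb, F. Y. Wu, *The one-dimensional Hubbard model: a reminiscence*, Physica A 321 (2003)
  1–27 = arXiv:cond-mat/0207529 (held; key `LiebWuPhysicaA2003`), §6: the expansion (rhosum) of
  `ρ₀`, the contour representation (rhoeye)–(eye), Lemma 5.
* G. E. Andrews, R. Askey, R. Roy, *Special Functions* (1999), §1.2 (1.2.5) (partial fractions of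
  `cot`; here for `1/sinh`), §4.9 (Poisson's integral for `J₀`).
-/

noncomputable section

open Complex MeasureTheory Set Filter Real intervalIntegral Metric
open scoped Topology

namespace Literature.Analysis.SpecialFunctions

/-! ### The Laplace transform of `cos(sω) J₀(ω)` -/

open Literature.Analysis.FunctionSpaces

/-- `∫₀^∞ e^{-cω} cos(bω) dω = c/(c² + b²)` for `c > 0`. [folklore] -/
theorem integral_exp_neg_mul_cos {c : ℝ} (hc : 0 < c) (b : ℝ) :
    ∫ ω in Ioi (0 : ℝ), Real.exp (-(c * ω)) * Real.cos (b * ω) = c / (c ^ 2 + b ^ 2) := by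
  set a : ℂ := -(c : ℂ) + b * I with ha
  have hare : a.re < 0 := by simp [ha, hc]
  have hint := integral_exp_mul_complex_Ioi hare 0
  have hI := integrableOn_exp_mul_complex_Ioi hare 0
  have hre := integral_re hI
  simp only [RCLike.re_to_complex] at hre
  rw [hint] at hre
  have hfun : (fun ω : ℝ => (Complex.exp (a * ω)).re) =
      fun ω => Real.exp (-(c * ω)) * Real.cos (b * ω) := by
    funext ω
    rw [Complex.exp_re]
    simp [ha, Complex.mul_re, Complex.mul_im]
  rw [hfun] at hre
  rw [hre]
  simp only [Complex.ofReal_zero, mul_zero, Complex.exp_zero]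
  have ha0 : a ≠ 0 := fun h => by rw [h, Complex.zero_re] at hare; exact lt_irrefl _ hare
  have hn : Complex.normSq a = c ^ 2 + b ^ 2 := by rw [Complex.normSq_apply]; simp [ha]; ring
  rw [neg_div, Complex.neg_re, Complex.div_re, Complex.one_re, Complex.one_im, hn]
  have hare' : a.re = -c := by simp [ha]
  rw [hare']
  ring

/-- The **Laplace transform of `cos(sω) J₀(ω)`**: for `c > 0` and real `s`,
`∫₀^∞ e^{-cω} cos(sω) J₀(ω) dω = π⁻¹ ∫₀^π c dθ/(c² + (s - cos θ)²)` (Poisson's integral for `J₀`,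
Fubini, and the Laplace transform of the cosine). [folklore] -/
theorem integral_exp_neg_mul_cos_mul_besselJ (s : ℝ) {c : ℝ} (hc : 0 < c) :
    ∫ ω in Ioi (0 : ℝ), Real.exp (-(c * ω)) * Real.cos (s * ω) * besselJ 0 ω =
      π⁻¹ * ∫ θ in (0 : ℝ)..π, c / (c ^ 2 + (s - Real.cos θ) ^ 2) := by
  -- the integrand on `(0, ∞) × [0, π]`
  set F : ℝ → ℝ → ℝ := fun θ ω => Real.exp (-(c * ω)) * Real.cos (s * ω) * Real.cos (ω * Real.cos θ)
    with hF
  -- Step 1: insert Poisson's integral and swap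
  have hstep1 : ∀ ω, Real.exp (-(c * ω)) * Real.cos (s * ω) * besselJ 0 ω =
      π⁻¹ * ∫ θ in (0 : ℝ)..π, F θ ω := by
    intro ω
    rw [besselJ_zero_eq_integral_cos_mul_cos, mul_left_comm, ← intervalIntegral.integral_const_mul]
  simp_rw [hstep1]
  rw [MeasureTheory.integral_const_mul]
  congr 1
  -- integrability on the product
  have hint : Integrable (Function.uncurry F)
      ((volume.restrict (Set.uIoc 0 π)).prod (volume.restrict (Ioi (0 : ℝ)))) := by
    haveI : IsFiniteMeasure (volume.restrict (Set.uIoc 0 π)) := by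
      refine isFiniteMeasure_restrict.2 ?_
      simp [Set.uIoc, Real.volume_Ioc]
    have hg : Integrable (fun z : ℝ × ℝ => (1 : ℝ) * Real.exp (-c * z.2))
        ((volume.restrict (Set.uIoc 0 π)).prod (volume.restrict (Ioi (0 : ℝ)))) :=
      Integrable.mul_prod (integrable_const 1) (exp_neg_integrableOn_Ioi 0 hc)
    refine hg.mono' ?_ (Eventually.of_forall fun z => ?_)
    · exact (by fun_prop : Continuous (Function.uncurry F)).aestronglyMeasurable
    · rcases z with ⟨θ, ω⟩
      simp only [Function.uncurry_apply_pair, hF, Real.norm_eq_abs, one_mul, neg_mul]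
      rw [abs_mul, abs_mul, Real.abs_exp]
      have h1 := Real.abs_cos_le_one (s * ω)
      have h2 := Real.abs_cos_le_one (ω * Real.cos θ)
      have h0 := Real.exp_pos (-(c * ω))
      calc Real.exp (-(c * ω)) * |Real.cos (s * ω)| * |Real.cos (ω * Real.cos θ)|
          ≤ Real.exp (-(c * ω)) * 1 * 1 := by gcongr
        _ = Real.exp (-(c * ω)) := by ring
  rw [← MeasureTheory.intervalIntegral_integral_swap hint]
  -- Step 2: the inner Laplace transforms
  have hinner : ∀ θ, ∫ ω in Ioi (0 : ℝ), F θ ω =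
      (c / (c ^ 2 + (s - Real.cos θ) ^ 2) + c / (c ^ 2 + (s + Real.cos θ) ^ 2)) / 2 := by
    intro θ
    have e : (fun ω => F θ ω) = fun ω => (1 / 2 : ℝ) * (Real.exp (-(c * ω)) * Real.cos ((s - Real.cos θ) * ω))
        + (1 / 2 : ℝ) * (Real.exp (-(c * ω)) * Real.cos ((s + Real.cos θ) * ω)) := by
      funext ω
      simp only [hF]
      rw [sub_mul, add_mul, Real.cos_sub, Real.cos_add]
      have : Real.cos θ * ω = ω * Real.cos θ := mul_comm _ _
      rw [this]
      ring
    rw [e]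
    have hi1 : IntegrableOn (fun ω => Real.exp (-(c * ω)) * Real.cos ((s - Real.cos θ) * ω)) (Ioi 0) := by
      refine Integrable.mono' (exp_neg_integrableOn_Ioi 0 hc) (by fun_prop : Continuous fun ω =>
        Real.exp (-(c * ω)) * Real.cos ((s - Real.cos θ) * ω)).aestronglyMeasurable
        (Eventually.of_forall fun ω => ?_)
      rw [Real.norm_eq_abs, abs_mul, Real.abs_exp, neg_mul]
      exact mul_le_of_le_one_right (Real.exp_pos _).le (Real.abs_cos_le_one _)
    have hi2 : IntegrableOn (fun ω => Real.exp (-(c * ω)) * Real.cos ((s + Real.cos θ) * ω)) (Ioi 0) := by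
      refine Integrable.mono' (exp_neg_integrableOn_Ioi 0 hc) (by fun_prop : Continuous fun ω =>
        Real.exp (-(c * ω)) * Real.cos ((s + Real.cos θ) * ω)).aestronglyMeasurable
        (Eventually.of_forall fun ω => ?_)
      rw [Real.norm_eq_abs, abs_mul, Real.abs_exp, neg_mul]
      exact mul_le_of_le_one_right (Real.exp_pos _).le (Real.abs_cos_le_one _)
    rw [integral_add (hi1.const_mul _) (hi2.const_mul _), MeasureTheory.integral_const_mul,
      MeasureTheory.integral_const_mul, integral_exp_neg_mul_cos hc, integral_exp_neg_mul_cos hc]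
    ring
  simp_rw [hinner]
  -- Step 3: the reflection `θ ↦ π - θ` identifies the two halves
  have hq1 : Continuous fun θ : ℝ => c / (c ^ 2 + (s - Real.cos θ) ^ 2) :=
    Continuous.div continuous_const (by fun_prop) fun θ => by positivity
  have hq2 : Continuous fun θ : ℝ => c / (c ^ 2 + (s + Real.cos θ) ^ 2) :=
    Continuous.div continuous_const (by fun_prop) fun θ => by positivity
  have hrefl : ∫ θ in (0 : ℝ)..π, c / (c ^ 2 + (s + Real.cos θ) ^ 2) =
      ∫ θ in (0 : ℝ)..π, c / (c ^ 2 + (s - Real.cos θ) ^ 2) := by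
    have h := intervalIntegral.integral_comp_sub_left
      (fun θ => c / (c ^ 2 + (s - Real.cos θ) ^ 2)) π (a := 0) (b := π)
    simp only [sub_self, sub_zero, Real.cos_pi_sub, sub_neg_eq_add] at h
    exact h
  rw [intervalIntegral.integral_div, intervalIntegral.integral_add (hq1.intervalIntegrable _ _)
    (hq2.intervalIntegrable _ _), hrefl]
  ring

/-! ### The mixture representation -/

/-- **Mixture representation**: for `c > 0` and real `s`,
`∫₀^∞ e^{-cω} cos(sω) J₀(ω) dω = π⁻¹ ∫_ℝ m(c, s, t) dt`. [folklore] -/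
theorem integral_exp_neg_mul_cos_mul_besselJ_eq_integral_cauchyMixKernel (s : ℝ) {c : ℝ} (hc : 0 < c) :
    ∫ ω in Ioi (0 : ℝ), Real.exp (-(c * ω)) * Real.cos (s * ω) * besselJ 0 ω =
      π⁻¹ * ∫ t : ℝ, cauchyMixKernel c s t := by
  rw [integral_exp_neg_mul_cos_mul_besselJ s hc, integral_pi_poissonCos_eq_integral_cauchyMixKernel s hc]

/-! ### The partial fraction expansion of `1/x - 1/sinh x` -/


/-- `coth(x/2) - coth x = 1/sinh x`. [folklore] -/
theorem coth_half_sub_coth {x : ℝ} (hx : x ≠ 0) :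
    Real.cosh (x / 2) / Real.sinh (x / 2) - Real.cosh x / Real.sinh x = 1 / Real.sinh x := by
  have hs : Real.sinh x ≠ 0 := Real.sinh_ne_zero.2 hx
  have hs2 : Real.sinh (x / 2) ≠ 0 := Real.sinh_ne_zero.2 (by positivity)
  have hx2 : x = 2 * (x / 2) := by ring
  have hsinh : Real.sinh x = 2 * Real.sinh (x / 2) * Real.cosh (x / 2) := by
    conv_lhs => rw [hx2, Real.sinh_two_mul]
  have hcosh : Real.cosh x = Real.cosh (x / 2) ^ 2 + Real.sinh (x / 2) ^ 2 := by
    conv_lhs => rw [hx2, Real.cosh_two_mul]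
  rw [hsinh, hcosh]
  have hc2 : Real.cosh (x / 2) ≠ 0 := (Real.cosh_pos _).ne'
  field_simp
  nlinarith [Real.cosh_sq (x / 2)]

/-- **`∑_{m ≥ 0} [2x/(x² + (2m+1)²π²) - 2x/(x² + (2m+2)²π²)] = 1/x - 1/sinh x`** for `x ≠ 0`
(the alternating form of the Mittag-Leffler expansion `1/sinh x = 1/x + ∑_{n ≥ 1} (-1)ⁿ 2x/(x² + n²π²)`,
from the expansions of `coth x` and `coth(x/2)`). [cite: AndrewsAskeyRoy1999, §1.2 (1.2.5)] -/
theorem hasSum_inv_sub_inv_sinh {x : ℝ} (hx : x ≠ 0) :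
    HasSum (fun m : ℕ => 2 * x / (x ^ 2 + (2 * m + 1) ^ 2 * π ^ 2) -
      2 * x / (x ^ 2 + (2 * m + 2) ^ 2 * π ^ 2)) (1 / x - 1 / Real.sinh x) := by
  set f : ℕ → ℝ := fun n => 2 * x / (x ^ 2 + (n + 1) ^ 2 * π ^ 2) with hf
  have h2 : HasSum f (Real.cosh x / Real.sinh x - 1 / x) := hasSum_coth_sub_inv hx
  have hx2 : x / 2 ≠ 0 := by positivity
  have h1 := hasSum_coth_sub_inv hx2
  -- `h1` says `∑ 2 f(2m+1) = coth(x/2) - 2/x`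
  have h1' : HasSum (fun m : ℕ => 2 * f (2 * m + 1))
      (Real.cosh (x / 2) / Real.sinh (x / 2) - 1 / (x / 2)) := by
    convert h1 using 1
    funext m
    simp only [hf]
    push_cast
    field_simp
    ring
  have hsf : Summable f := h2.summable
  have he : Summable fun m : ℕ => f (2 * m) :=
    hsf.comp_injective (fun a b h => by simpa using h)
  have ho : Summable fun m : ℕ => f (2 * m + 1) :=
    hsf.comp_injective (fun a b h => by simpa using h)
  have hsplit := tsum_even_add_odd he ho
  rw [h2.tsum_eq] at hsplit
  have ho' : ∑' m, f (2 * m + 1) = (Real.cosh (x / 2) / Real.sinh (x / 2) - 1 / (x / 2)) / 2 := by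
    have := h1'.tsum_eq
    rw [tsum_mul_left] at this
    linarith
  have key : HasSum (fun m : ℕ => f (2 * m) - f (2 * m + 1))
      (∑' m, f (2 * m) - ∑' m, f (2 * m + 1)) := he.hasSum.sub ho.hasSum
  have hval : ∑' m, f (2 * m) - ∑' m, f (2 * m + 1) = 1 / x - 1 / Real.sinh x := by
    have e : ∑' m, f (2 * m) = Real.cosh x / Real.sinh x - 1 / x - ∑' m, f (2 * m + 1) := by
      linarith
    rw [e, ho', ← coth_half_sub_coth hx]
    field_simp
    ring
  rw [hval] at key
  convert key using 1
  funext m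
  simp only [hf]
  push_cast
  ring_nf

/-- The rescaled expansion: for `β > 0`, `a > 0`,
`∑_{m ≥ 0} [β/(β² + ((2m+1)a)²) - β/(β² + ((2m+2)a)²)] = 1/(2β) - (π/(2a))/sinh(πβ/a)`.
[cite: AndrewsAskeyRoy1999, §1.2 (1.2.5)] -/
theorem hasSum_cauchy_alternating {β a : ℝ} (hβ : 0 < β) (ha : 0 < a) :
    HasSum (fun m : ℕ => β / (β ^ 2 + ((2 * m + 1) * a) ^ 2) - β / (β ^ 2 + ((2 * m + 2) * a) ^ 2))
      (1 / (2 * β) - π / (2 * a) / Real.sinh (π * β / a)) := by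
  set x : ℝ := π * β / a with hx
  have hx0 : x ≠ 0 := by positivity
  have h := (hasSum_inv_sub_inv_sinh hx0).mul_left (π / (2 * a))
  have hfun : (fun m : ℕ => β / (β ^ 2 + ((2 * m + 1) * a) ^ 2) - β / (β ^ 2 + ((2 * m + 2) * a) ^ 2)) =
      fun m : ℕ => π / (2 * a) * (2 * x / (x ^ 2 + (2 * m + 1) ^ 2 * π ^ 2) -
        2 * x / (x ^ 2 + (2 * m + 2) ^ 2 * π ^ 2)) := by
    funext m
    simp only [hx]
    field_simp
  have hval : 1 / (2 * β) - π / (2 * a) / Real.sinh x = π / (2 * a) * (1 / x - 1 / Real.sinh x) := by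
    have hsx : Real.sinh x ≠ 0 := Real.sinh_ne_zero.2 hx0
    simp only [hx] at hsx ⊢
    field_simp
  rw [hfun, hval]
  exact h

/-! ### The alternating series for the Fermi-weighted integral -/

/-- The Laplace transform `P(c, s) = ∫₀^∞ e^{-cω} cos(sω) J₀(ω) dω`. [folklore] -/
def laplaceCosJ0 (c s : ℝ) : ℝ := ∫ ω in Ioi (0 : ℝ), Real.exp (-(c * ω)) * Real.cos (s * ω) * besselJ 0 ω

/-- The Fermi-weighted integral `I(a, s) = ∫₀^∞ cos(sω) J₀(ω) / (1 + e^{aω}) dω`.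
[cite: LiebWuPhysicaA2003, §6, formula for ρ₀(k)] -/
def fermiCosJ0 (a s : ℝ) : ℝ := ∫ ω in Ioi (0 : ℝ), Real.cos (s * ω) * besselJ 0 ω / (1 + Real.exp (a * ω))

/-- `laplaceCosJ0` in mixture form (`c > 0`, `|s| < 1`). [folklore] -/
theorem laplaceCosJ0_eq_cauchyMixKernel {c s : ℝ} (hc : 0 < c) :
    laplaceCosJ0 c s = π⁻¹ * ∫ t : ℝ, cauchyMixKernel c s t :=
  integral_exp_neg_mul_cos_mul_besselJ_eq_integral_cauchyMixKernel s hc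

/-- `laplaceCosJ0` is decreasing in `c > 0`. [folklore] -/
theorem laplaceCosJ0_antitone {s : ℝ} (hs : |s| < 1) {c₁ c₂ : ℝ} (hc₁ : 0 < c₁) (h : c₁ ≤ c₂) :
    laplaceCosJ0 c₂ s ≤ laplaceCosJ0 c₁ s := by
  rw [laplaceCosJ0_eq_cauchyMixKernel hc₁, laplaceCosJ0_eq_cauchyMixKernel (hc₁.trans_le h)]
  refine mul_le_mul_of_nonneg_left ?_ (by positivity)
  exact integral_mono (integrable_cauchyMixKernel c₂ hs) (integrable_cauchyMixKernel c₁ hs)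
    fun t => cauchyMixKernel_antitone hs t hc₁.le h

/-- `laplaceCosJ0` is strictly decreasing in `c > 0`. [folklore] -/
theorem laplaceCosJ0_strictAnti {s : ℝ} (hs : |s| < 1) {c₁ c₂ : ℝ} (hc₁ : 0 < c₁) (h : c₁ < c₂) :
    laplaceCosJ0 c₂ s < laplaceCosJ0 c₁ s := by
  rw [laplaceCosJ0_eq_cauchyMixKernel hc₁, laplaceCosJ0_eq_cauchyMixKernel (hc₁.trans h), ← sub_pos, ← mul_sub,
    ← integral_sub (integrable_cauchyMixKernel c₁ hs) (integrable_cauchyMixKernel c₂ hs)]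
  refine mul_pos (by positivity) ?_
  have hnn : 0 ≤ fun t => cauchyMixKernel c₁ s t - cauchyMixKernel c₂ s t :=
    fun t => sub_nonneg.2 (cauchyMixKernel_antitone hs t hc₁.le h.le)
  rw [integral_pos_iff_support_of_nonneg hnn
    ((integrable_cauchyMixKernel c₁ hs).sub (integrable_cauchyMixKernel c₂ hs))]
  have hsupp : Function.support (fun t => cauchyMixKernel c₁ s t - cauchyMixKernel c₂ s t) = Set.univ := by
    refine Set.eq_univ_of_forall fun t => ?_
    rw [Function.mem_support]
    exact (sub_pos.2 (cauchyMixKernel_strictAnti hs t hc₁.le h)).ne'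
  rw [hsupp, Real.volume_univ]
  exact ENNReal.zero_lt_top

/-- Integrability of `e^{-cω} cos(sω) J₀(ω)` on `(0, ∞)` for `c > 0`. [folklore] -/
theorem integrableOn_exp_neg_mul_cos_mul_besselJ {c : ℝ} (hc : 0 < c) (s : ℝ) :
    IntegrableOn (fun ω => Real.exp (-(c * ω)) * Real.cos (s * ω) * besselJ 0 ω) (Ioi 0) := by
  have hJ : Continuous (besselJ 0) := continuous_besselJ_holds 0
  have hc' : Continuous fun ω => Real.exp (-(c * ω)) * Real.cos (s * ω) * besselJ 0 ω := by fun_prop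
  refine Integrable.mono' (exp_neg_integrableOn_Ioi 0 hc) hc'.aestronglyMeasurable
    (Eventually.of_forall fun ω => ?_)
  rw [Real.norm_eq_abs, abs_mul, abs_mul, Real.abs_exp, neg_mul]
  have h1 := Real.abs_cos_le_one (s * ω)
  have h2 := abs_besselJ_zero_le_one_holds ω
  have h0 := Real.exp_pos (-(c * ω))
  calc Real.exp (-(c * ω)) * |Real.cos (s * ω)| * |besselJ 0 ω|
      ≤ Real.exp (-(c * ω)) * 1 * 1 := by gcongr
    _ = Real.exp (-(c * ω)) := by ring

/-- Alternating geometric partial sums: `(1 + x) Σ_{n<N} (-1)ⁿ x^{n+1} = x (1 - (-1)^N x^N)`.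
[folklore] -/
theorem one_add_mul_alternating_geom (x : ℝ) (N : ℕ) :
    (1 + x) * ∑ n ∈ Finset.range N, (-1 : ℝ) ^ n * x ^ (n + 1) = x * (1 - (-1) ^ N * x ^ N) := by
  induction N with
  | zero => simp
  | succ N ih =>
    rw [Finset.sum_range_succ, mul_add, ih]
    ring

/-- Bound on the alternating geometric partial sums for `0 ≤ x ≤ 1`: `|Σ_{n<N} (-1)ⁿ x^{n+1}| ≤ 2x`.
[folklore] -/
theorem abs_alternating_geom_le {x : ℝ} (hx0 : 0 ≤ x) (hx1 : x ≤ 1) (N : ℕ) :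
    |∑ n ∈ Finset.range N, (-1 : ℝ) ^ n * x ^ (n + 1)| ≤ 2 * x := by
  have h := one_add_mul_alternating_geom x N
  have h1x : 0 < 1 + x := by linarith
  have hS : ∑ n ∈ Finset.range N, (-1 : ℝ) ^ n * x ^ (n + 1) = x * (1 - (-1) ^ N * x ^ N) / (1 + x) := by
    rw [eq_div_iff h1x.ne', mul_comm]; exact h
  rw [hS, abs_div, abs_of_pos h1x, div_le_iff₀ h1x, abs_mul, abs_of_nonneg hx0]
  have hpow : |(-1 : ℝ) ^ N * x ^ N| ≤ 1 := by
    rw [abs_mul, abs_pow, abs_neg, abs_one, one_pow, one_mul, abs_pow, abs_of_nonneg hx0]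
    exact pow_le_one₀ hx0 hx1
  have h2 : |1 - (-1 : ℝ) ^ N * x ^ N| ≤ 2 := by
    have := abs_sub_le (1 : ℝ) 0 ((-1 : ℝ) ^ N * x ^ N)
    simp only [sub_zero, abs_one, zero_sub, abs_neg] at this
    linarith
  nlinarith [abs_nonneg (1 - (-1 : ℝ) ^ N * x ^ N)]

/-- Limit of the alternating geometric partial sums for `0 ≤ x < 1`: `x/(1+x)`. [folklore] -/
theorem tendsto_alternating_geom {x : ℝ} (hx0 : 0 ≤ x) (hx1 : x < 1) :
    Tendsto (fun N => ∑ n ∈ Finset.range N, (-1 : ℝ) ^ n * x ^ (n + 1)) atTop (𝓝 (x / (1 + x))) := by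
  have h1x : 0 < 1 + x := by linarith
  have hS : ∀ N, ∑ n ∈ Finset.range N, (-1 : ℝ) ^ n * x ^ (n + 1) =
      x / (1 + x) - x / (1 + x) * (-x) ^ N := by
    intro N
    have h := one_add_mul_alternating_geom x N
    rw [neg_pow]
    field_simp
    linarith
  simp_rw [hS]
  have hlim : Tendsto (fun N => (-x) ^ N) atTop (𝓝 0) :=
    tendsto_pow_atTop_nhds_zero_of_abs_lt_one (by rw [abs_neg, abs_of_nonneg hx0]; exact hx1)
  have := (hlim.const_mul (x / (1 + x))).const_sub (x / (1 + x))
  simpa using this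

/-- **The alternating series**: for `a > 0`,
`∑_{n<N} (-1)ⁿ P((n+1)a, s) → I(a, s) = ∫₀^∞ cos(sω) J₀(ω)/(1 + e^{aω}) dω` (expand the Fermi
factor `1/(1 + e^{aω}) = Σ_{n ≥ 1} (-1)^{n+1} e^{-naω}`; dominated convergence with the bound
`2 e^{-aω}` on the partial sums). [cite: LiebWuPhysicaA2003, §6, expansion (rhosum)] -/
theorem tendsto_sum_laplaceCosJ0 {a : ℝ} (ha : 0 < a) (s : ℝ) :
    Tendsto (fun N => ∑ n ∈ Finset.range N, (-1 : ℝ) ^ n * laplaceCosJ0 ((n + 1) * a) s) atTop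
      (𝓝 (fermiCosJ0 a s)) := by
  have hJ : Continuous (besselJ 0) := continuous_besselJ_holds 0
  -- the partial sums of the integrands
  set F : ℕ → ℝ → ℝ := fun N ω => ∑ n ∈ Finset.range N,
    (-1 : ℝ) ^ n * (Real.exp (-((n + 1) * a * ω)) * Real.cos (s * ω) * besselJ 0 ω) with hF
  have hFeq : ∀ N ω, F N ω = Real.cos (s * ω) * besselJ 0 ω *
      ∑ n ∈ Finset.range N, (-1 : ℝ) ^ n * Real.exp (-(a * ω)) ^ (n + 1) := by
    intro N ω
    simp only [hF, Finset.mul_sum]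
    refine Finset.sum_congr rfl fun n _ => ?_
    have : Real.exp (-((n + 1) * a * ω)) = Real.exp (-(a * ω)) ^ (n + 1) := by
      rw [← Real.exp_nat_mul]
      congr 1
      push_cast
      ring
    rw [this]
    ring
  -- the integrals of the partial sums
  have hint : ∀ N, ∫ ω in Ioi (0 : ℝ), F N ω = ∑ n ∈ Finset.range N, (-1 : ℝ) ^ n * laplaceCosJ0 ((n + 1) * a) s := by
    intro N
    simp only [hF]
    rw [MeasureTheory.integral_finsetSum]
    · refine Finset.sum_congr rfl fun n _ => ?_
      rw [MeasureTheory.integral_const_mul, laplaceCosJ0]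
    · intro n _
      exact (integrableOn_exp_neg_mul_cos_mul_besselJ (by positivity) s).const_mul _
  have hlim := tendsto_integral_of_dominated_convergence (fun ω => 2 * Real.exp (-(a * ω)))
    (μ := volume.restrict (Ioi (0 : ℝ))) (F := F)
    (f := fun ω => Real.cos (s * ω) * besselJ 0 ω / (1 + Real.exp (a * ω))) ?_ ?_ ?_ ?_
  · simp_rw [hint] at hlim
    exact hlim
  · intro N
    exact (by simp only [hF]; fun_prop : Continuous (F N)).aestronglyMeasurable
  · exact ((exp_neg_integrableOn_Ioi 0 ha).const_mul 2).congr
      (Eventually.of_forall fun ω => by simp [neg_mul])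
  · intro N
    filter_upwards [ae_restrict_mem measurableSet_Ioi] with ω hω
    have hω : (0 : ℝ) < ω := hω
    set x := Real.exp (-(a * ω)) with hx
    have hx0 : 0 ≤ x := (Real.exp_pos _).le
    have hx1 : x ≤ 1 := by
      rw [hx, Real.exp_le_one_iff]
      have := mul_pos ha hω
      linarith
    rw [hFeq, Real.norm_eq_abs, abs_mul, abs_mul]
    have h1 := Real.abs_cos_le_one (s * ω)
    have h2 := abs_besselJ_zero_le_one_holds ω
    have h3 := abs_alternating_geom_le hx0 hx1 N
    calc |Real.cos (s * ω)| * |besselJ 0 ω| * |∑ n ∈ Finset.range N, (-1 : ℝ) ^ n * x ^ (n + 1)|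
        ≤ 1 * 1 * (2 * x) := by gcongr
      _ = 2 * x := by ring
  · filter_upwards [ae_restrict_mem measurableSet_Ioi] with ω hω
    have hω : (0 : ℝ) < ω := hω
    set x := Real.exp (-(a * ω)) with hx
    have hx0 : 0 ≤ x := (Real.exp_pos _).le
    have hx1 : x < 1 := by
      rw [hx, Real.exp_lt_one_iff]
      have := mul_pos ha hω
      linarith
    have hval : x / (1 + x) = 1 / (1 + Real.exp (a * ω)) := by
      have hxe : x * Real.exp (a * ω) = 1 := by rw [hx, ← Real.exp_add]; simp
      have h1x : 0 < 1 + x := by linarith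
      field_simp
      linarith
    simp_rw [hFeq]
    have := (tendsto_alternating_geom hx0 hx1).const_mul (Real.cos (s * ω) * besselJ 0 ω)
    rw [hval] at this
    convert this using 2
    ring

/-- Pairing consecutive terms of the alternating series. [folklore] -/
theorem sum_range_two_mul_laplaceCosJ0 (a s : ℝ) (M : ℕ) :
    ∑ n ∈ Finset.range (2 * M), (-1 : ℝ) ^ n * laplaceCosJ0 ((n + 1) * a) s =
      ∑ m ∈ Finset.range M, (laplaceCosJ0 ((2 * m + 1) * a) s - laplaceCosJ0 ((2 * m + 2) * a) s) := by
  induction M with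
  | zero => simp
  | succ M ih =>
    rw [show 2 * (M + 1) = 2 * M + 1 + 1 by ring, Finset.sum_range_succ, Finset.sum_range_succ, ih,
      Finset.sum_range_succ]
    have e1 : (-1 : ℝ) ^ (2 * M) = 1 := by rw [pow_mul]; simp
    have e2 : (-1 : ℝ) ^ (2 * M + 1) = -1 := by rw [pow_succ, e1]; simp
    have c1 : ((2 * M : ℕ) : ℝ) + 1 = 2 * (M : ℝ) + 1 := by push_cast; ring
    have c2 : ((2 * M + 1 : ℕ) : ℝ) + 1 = 2 * (M : ℝ) + 2 := by push_cast; ring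
    rw [e1, e2, c1, c2]
    ring

/-- The paired terms `D_m = P((2m+1)a, s) - P((2m+2)a, s)` are nonnegative. [folklore] -/
theorem laplaceCosJ0_pair_nonneg {a s : ℝ} (ha : 0 < a) (hs : |s| < 1) (m : ℕ) :
    0 ≤ laplaceCosJ0 ((2 * m + 1) * a) s - laplaceCosJ0 ((2 * m + 2) * a) s :=
  sub_nonneg.2 (laplaceCosJ0_antitone hs (by positivity) (by nlinarith))

/-- **`I(a, s) = Σ_m D_m`** as a convergent series of nonnegative terms.
[cite: LiebWuPhysicaA2003, §6, expansion (rhosum)] -/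
theorem hasSum_laplaceCosJ0_pair {a s : ℝ} (ha : 0 < a) (hs : |s| < 1) :
    HasSum (fun m : ℕ => laplaceCosJ0 ((2 * m + 1) * a) s - laplaceCosJ0 ((2 * m + 2) * a) s) (fermiCosJ0 a s) := by
  rw [hasSum_iff_tendsto_nat_of_nonneg (laplaceCosJ0_pair_nonneg ha hs)]
  have h := tendsto_sum_laplaceCosJ0 ha s
  have h2 : Tendsto (fun M : ℕ => 2 * M) atTop atTop :=
    tendsto_atTop_mono (fun M => by show M ≤ 2 * M; omega) tendsto_id
  have := h.comp h2
  refine this.congr fun M => ?_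
  simp only [Function.comp]
  exact sum_range_two_mul_laplaceCosJ0 a s M

/-- **Positivity**: `I(a, s) > 0` for `a > 0`, `|s| < 1`. [cite: LiebWuPhysicaA2003, §6 Lemma 5] -/
theorem fermiCosJ0_pos {a s : ℝ} (ha : 0 < a) (hs : |s| < 1) : 0 < fermiCosJ0 a s := by
  have h := hasSum_laplaceCosJ0_pair ha hs
  have h0 : 0 < laplaceCosJ0 ((2 * (0 : ℕ) + 1) * a) s - laplaceCosJ0 ((2 * (0 : ℕ) + 2) * a) s := by
    refine sub_pos.2 (laplaceCosJ0_strictAnti hs (by positivity) ?_)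
    push_cast; linarith
  exact h0.trans_le (le_hasSum h 0 fun j _ => laplaceCosJ0_pair_nonneg ha hs j)

/-! ### Lieb–Wu's representation and the bound `2 I(a, s) < 1/√(1 - s²)` -/

/-- The paired difference of mixture kernels, pointwise. [folklore] -/
theorem cauchyMixKernel_sub_cauchyMixKernel (c₁ c₂ s t : ℝ) :
    cauchyMixKernel c₁ s t - cauchyMixKernel c₂ s t = 1 / (2 * √(1 + t ^ 2)) *
      (((√(1 + t ^ 2) - s) / ((√(1 + t ^ 2) - s) ^ 2 + c₁ ^ 2) -
          (√(1 + t ^ 2) - s) / ((√(1 + t ^ 2) - s) ^ 2 + c₂ ^ 2)) +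
        ((√(1 + t ^ 2) + s) / ((√(1 + t ^ 2) + s) ^ 2 + c₁ ^ 2) -
          (√(1 + t ^ 2) + s) / ((√(1 + t ^ 2) + s) ^ 2 + c₂ ^ 2))) := by
  unfold cauchyMixKernel
  ring

/-- The **sinh remainder** `R(t) = (1/(2b)) (π/(2a)) [1/sinh(π(b-s)/a) + 1/sinh(π(b+s)/a)]`,
`b = √(1+t²)` (the integrand of Lieb–Wu's `I₋ + I₊`).
[cite: LiebWuPhysicaA2003, §6, the integrals I±(k)] -/
def fermiCosJ0Rem (a s t : ℝ) : ℝ :=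
  1 / (2 * √(1 + t ^ 2)) * (π / (2 * a)) *
    (1 / Real.sinh (π * (√(1 + t ^ 2) - s) / a) + 1 / Real.sinh (π * (√(1 + t ^ 2) + s) / a))

/-- Pointwise sum of the paired differences:
`Σ_m [m((2m+1)a) - m((2m+2)a)](t) = (1/2) m(0, s, t) - R(t)`. [folklore] -/
theorem hasSum_cauchyMixKernel_pair {a s : ℝ} (ha : 0 < a) (hs : |s| < 1) (t : ℝ) :
    HasSum (fun m : ℕ => cauchyMixKernel ((2 * m + 1) * a) s t - cauchyMixKernel ((2 * m + 2) * a) s t)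
      (1 / 2 * cauchyMixKernel 0 s t - fermiCosJ0Rem a s t) := by
  have h1 := sqrt_one_add_sq_sub_pos hs t
  have h2 := sqrt_one_add_sq_add_pos hs t
  set b := √(1 + t ^ 2) with hb
  have hb0 : 0 < b := by linarith [(abs_lt.1 hs).2]
  have hsum := ((hasSum_cauchy_alternating h1 ha).add (hasSum_cauchy_alternating h2 ha)).mul_left
    (1 / (2 * b))
  have e0 : cauchyMixKernel 0 s t = 1 / (2 * b) * (1 / (b - s) + 1 / (b + s)) := by
    unfold cauchyMixKernel
    rw [← hb]
    congr 1
    have h4 : (b - s) ^ 2 + 0 ^ 2 = (b - s) * (b - s) := by ring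
    have h5 : (b + s) ^ 2 + 0 ^ 2 = (b + s) * (b + s) := by ring
    rw [h4, h5, div_mul_cancel_right₀ h1.ne', div_mul_cancel_right₀ h2.ne', one_div, one_div]
  have hfun : (fun m : ℕ => cauchyMixKernel ((2 * m + 1) * a) s t - cauchyMixKernel ((2 * m + 2) * a) s t) =
      fun m : ℕ => 1 / (2 * b) * (((b - s) / ((b - s) ^ 2 + ((2 * m + 1) * a) ^ 2) -
          (b - s) / ((b - s) ^ 2 + ((2 * m + 2) * a) ^ 2)) +
        ((b + s) / ((b + s) ^ 2 + ((2 * m + 1) * a) ^ 2) -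
          (b + s) / ((b + s) ^ 2 + ((2 * m + 2) * a) ^ 2))) := by
    funext m
    rw [cauchyMixKernel_sub_cauchyMixKernel, ← hb]
  have hval : 1 / 2 * cauchyMixKernel 0 s t - fermiCosJ0Rem a s t = 1 / (2 * b) *
      (1 / (2 * (b - s)) - π / (2 * a) / Real.sinh (π * (b - s) / a) +
        (1 / (2 * (b + s)) - π / (2 * a) / Real.sinh (π * (b + s) / a))) := by
    rw [e0]
    unfold fermiCosJ0Rem
    rw [← hb]
    set p := b - s with hp
    set q := b + s with hq
    ring
  rw [hfun, hval]
  exact hsum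

/-- `R(t) > 0`. [folklore] -/
theorem fermiCosJ0Rem_pos {a s : ℝ} (ha : 0 < a) (hs : |s| < 1) (t : ℝ) : 0 < fermiCosJ0Rem a s t := by
  have h1 := sqrt_one_add_sq_sub_pos hs t
  have h2 := sqrt_one_add_sq_add_pos hs t
  have hb0 : 0 < √(1 + t ^ 2) := by linarith [(abs_lt.1 hs).2]
  have hs1 : 0 < Real.sinh (π * (√(1 + t ^ 2) - s) / a) := Real.sinh_pos_iff.2 (by positivity)
  have hs2 : 0 < Real.sinh (π * (√(1 + t ^ 2) + s) / a) := Real.sinh_pos_iff.2 (by positivity)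
  unfold fermiCosJ0Rem
  positivity

/-- `R(t) ≤ (1/2) m(0, s, t)` (from `sinh y ≥ y`). [folklore] -/
theorem fermiCosJ0Rem_le {a s : ℝ} (ha : 0 < a) (hs : |s| < 1) (t : ℝ) :
    fermiCosJ0Rem a s t ≤ 1 / 2 * cauchyMixKernel 0 s t := by
  have h1 := sqrt_one_add_sq_sub_pos hs t
  have h2 := sqrt_one_add_sq_add_pos hs t
  set b := √(1 + t ^ 2) with hb
  have hb0 : 0 < b := by linarith [(abs_lt.1 hs).2]
  have key : ∀ β : ℝ, 0 < β → π / (2 * a) * (1 / Real.sinh (π * β / a)) ≤ 1 / 2 * (1 / β) := by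
    intro β hβ
    have hy : 0 < π * β / a := by positivity
    have hsy : π * β / a ≤ Real.sinh (π * β / a) := Real.self_le_sinh_iff.2 hy.le
    calc π / (2 * a) * (1 / Real.sinh (π * β / a)) ≤ π / (2 * a) * (1 / (π * β / a)) :=
          mul_le_mul_of_nonneg_left (one_div_le_one_div_of_le hy hsy) (by positivity)
      _ = 1 / 2 * (1 / β) := by field_simp
  have e0 : cauchyMixKernel 0 s t = 1 / (2 * b) * (1 / (b - s) + 1 / (b + s)) := by
    unfold cauchyMixKernel
    rw [← hb]
    congr 1
    have h4 : (b - s) ^ 2 + 0 ^ 2 = (b - s) * (b - s) := by ring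
    have h5 : (b + s) ^ 2 + 0 ^ 2 = (b + s) * (b + s) := by ring
    rw [h4, h5, div_mul_cancel_right₀ h1.ne', div_mul_cancel_right₀ h2.ne', one_div, one_div]
  rw [e0]
  unfold fermiCosJ0Rem
  rw [← hb]
  have hk1 := key (b - s) h1
  have hk2 := key (b + s) h2
  have hb2 : 0 < 1 / (2 * b) := by positivity
  calc 1 / (2 * b) * (π / (2 * a)) * (1 / Real.sinh (π * (b - s) / a) + 1 / Real.sinh (π * (b + s) / a))
      = 1 / (2 * b) * (π / (2 * a) * (1 / Real.sinh (π * (b - s) / a)) +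
          π / (2 * a) * (1 / Real.sinh (π * (b + s) / a))) := by ring
    _ ≤ 1 / (2 * b) * (1 / 2 * (1 / (b - s)) + 1 / 2 * (1 / (b + s))) := by gcongr
    _ = 1 / 2 * (1 / (2 * b) * (1 / (b - s) + 1 / (b + s))) := by ring

/-- Continuity of `R`. [folklore] -/
theorem continuous_fermiCosJ0Rem {a s : ℝ} (ha : 0 < a) (hs : |s| < 1) : Continuous fun t => fermiCosJ0Rem a s t := by
  unfold fermiCosJ0Rem
  refine Continuous.mul (Continuous.mul ?_ continuous_const) (Continuous.add ?_ ?_)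
  · refine Continuous.div continuous_const (by fun_prop) fun t => ?_
    have := one_le_sqrt_one_add_sq t
    positivity
  · refine Continuous.div continuous_const (by fun_prop) fun t => ?_
    have := sqrt_one_add_sq_sub_pos hs t
    exact (Real.sinh_pos_iff.2 (by positivity)).ne'
  · refine Continuous.div continuous_const (by fun_prop) fun t => ?_
    have := sqrt_one_add_sq_add_pos hs t
    exact (Real.sinh_pos_iff.2 (by positivity)).ne'

/-- Integrability of `R`. [folklore] -/
theorem integrable_fermiCosJ0Rem {a s : ℝ} (ha : 0 < a) (hs : |s| < 1) : Integrable fun t => fermiCosJ0Rem a s t := by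
  refine Integrable.mono' ((integrable_cauchyMixKernel 0 hs).const_mul (1 / 2))
    (continuous_fermiCosJ0Rem ha hs).aestronglyMeasurable (Eventually.of_forall fun t => ?_)
  rw [Real.norm_eq_abs, abs_of_pos (fermiCosJ0Rem_pos ha hs t)]
  exact fermiCosJ0Rem_le ha hs t

/-- `∫ R > 0`. [cite: LiebWuPhysicaA2003, §6, proof of Lemma 5] -/
theorem integral_fermiCosJ0Rem_pos {a s : ℝ} (ha : 0 < a) (hs : |s| < 1) : 0 < ∫ t, fermiCosJ0Rem a s t := by
  rw [integral_pos_iff_support_of_nonneg (fun t => (fermiCosJ0Rem_pos ha hs t).le) (integrable_fermiCosJ0Rem ha hs)]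
  have hsupp : Function.support (fun t => fermiCosJ0Rem a s t) = Set.univ :=
    Set.eq_univ_of_forall fun t => (Function.mem_support.2 (fermiCosJ0Rem_pos ha hs t).ne')
  rw [hsupp, Real.volume_univ]
  exact ENNReal.zero_lt_top

/-- **Lieb–Wu's representation of the Fermi-weighted integral** (the real form of the contour
formula (rhoeye) of Physica A 321 (2003) §6): for `a > 0`, `|s| < 1`,
`π I(a, s) = (1/2) π/√(1-s²) - ∫_ℝ R(t) dt`.
[cite: LiebWuPhysicaA2003, §6, representation of ρ₀ via I±(k) preceding Lemma 5] -/
theorem pi_mul_fermiCosJ0_eq {a s : ℝ} (ha : 0 < a) (hs : |s| < 1) :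
    π * fermiCosJ0 a s = 1 / 2 * (π / √(1 - s ^ 2)) - ∫ t, fermiCosJ0Rem a s t := by
  have hD := hasSum_laplaceCosJ0_pair ha hs
  -- `π D_m = ∫ d_m`
  set d : ℕ → ℝ → ℝ := fun m t => cauchyMixKernel ((2 * m + 1) * a) s t - cauchyMixKernel ((2 * m + 2) * a) s t
    with hd
  have hdint : ∀ m, Integrable (d m) := fun m =>
    (integrable_cauchyMixKernel _ hs).sub (integrable_cauchyMixKernel _ hs)
  have hdnn : ∀ m t, 0 ≤ d m t := fun m t =>
    sub_nonneg.2 (cauchyMixKernel_antitone hs t (by positivity) (by nlinarith))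
  have hDm : ∀ m : ℕ, laplaceCosJ0 ((2 * m + 1) * a) s - laplaceCosJ0 ((2 * m + 2) * a) s = π⁻¹ * ∫ t, d m t := by
    intro m
    rw [laplaceCosJ0_eq_cauchyMixKernel (by positivity), laplaceCosJ0_eq_cauchyMixKernel (by positivity), ← mul_sub,
      ← integral_sub (integrable_cauchyMixKernel _ hs) (integrable_cauchyMixKernel _ hs)]
  -- summability of `∫ ‖d_m‖ = π D_m`
  have hnorm : ∀ m, ∫ t, ‖d m t‖ = π * (laplaceCosJ0 ((2 * m + 1) * a) s - laplaceCosJ0 ((2 * m + 2) * a) s) := by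
    intro m
    rw [hDm]
    rw [show (fun t => ‖d m t‖) = d m from funext fun t => by
      rw [Real.norm_eq_abs, abs_of_nonneg (hdnn m t)]]
    field_simp
  have hsum : Summable fun m => ∫ t, ‖d m t‖ := by
    simp_rw [hnorm]
    exact hD.summable.mul_left π
  have hswap := integral_tsum_of_summable_integral_norm hdint hsum
  -- pointwise sums
  have hpt : (fun t => ∑' m, d m t) = fun t => 1 / 2 * cauchyMixKernel 0 s t - fermiCosJ0Rem a s t :=
    funext fun t => (hasSum_cauchyMixKernel_pair ha hs t).tsum_eq
  rw [hpt, integral_sub ((integrable_cauchyMixKernel 0 hs).const_mul _) (integrable_fermiCosJ0Rem ha hs),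
    MeasureTheory.integral_const_mul, integral_cauchyMixKernel_zero hs] at hswap
  -- `π I = Σ π D_m = Σ ∫ d_m`
  have hπD : HasSum (fun m : ℕ => ∫ t, d m t) (π * fermiCosJ0 a s) := by
    have := hD.mul_left π
    refine this.congr_fun fun m => ?_
    rw [hDm]
    field_simp
  rw [← hπD.tsum_eq, hswap]

/-- **The key inequality (Lieb–Wu 2003, Lemma 5 in integral form)**: for `a > 0` and `|s| < 1`,
`2 ∫₀^∞ cos(sω) J₀(ω)/(1 + e^{aω}) dω < 1/√(1 - s²)`. [cite: LiebWuPhysicaA2003, §6 Lemma 5] -/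
theorem two_mul_fermiCosJ0_lt {a s : ℝ} (ha : 0 < a) (hs : |s| < 1) :
    2 * fermiCosJ0 a s < 1 / √(1 - s ^ 2) := by
  have h := pi_mul_fermiCosJ0_eq ha hs
  have hR := integral_fermiCosJ0Rem_pos ha hs
  have hπ := Real.pi_pos
  have hs2 : 0 < 1 - s ^ 2 := by have := abs_lt.1 hs; nlinarith
  have hr : 0 < √(1 - s ^ 2) := Real.sqrt_pos.2 hs2
  have : π * (2 * fermiCosJ0 a s) < π * (1 / √(1 - s ^ 2)) := by
    have e : π * (1 / √(1 - s ^ 2)) = 2 * (1 / 2 * (π / √(1 - s ^ 2))) := by ring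
    rw [e]
    nlinarith
  exact lt_of_mul_lt_mul_left this hπ.le

end Literature.Analysis.SpecialFunctions
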